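import Literature.NumberTheory.LFunctions.WeilDigammaTails
import Literature.NumberTheory.LFunctions.WeilSharpConstants
import HarnessLib

/-!
# Integer evaluation of the certified digamma series

Topic: `Literature/NumberTheory/LFunctions` (certified numerics for the archimedean Weil weight
`Re ψ(1/4 + it/2) = ψ(1/4) + Σ_m f_{l_m}(t)`; `WeilPositivityMinorant.lean`, `WeilDigammaTails.lean`).

For a dyadic abscissa `u = a/2^j` (`j ≥ 1`) the terms of the series and of its Taylor-type
coefficient sums are rationals with the common denominator structure
`l_m² + u² = N_m/4^j`, `N_m = (4m+1)² 4^{j−1} + a²` (`nodeSqZ`), so that the directed roundings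
`⌊2^p · 2l_m/(l_m² + u²)^{k+2}⌋`, `⌈…⌉`, `⌊2^p · f_{l_m}(u)⌋` are single natural-number divisions
(`aTermLoZ`, `aTermHiZ`, `wTermLoZ`). Their sums `aLoZ`, `aHiZ`, `wSumLoZ` (structural `sumN`) are
evaluated by the kernel with GMP arithmetic only — about thirty times faster than the rational
forms `aLoQ`, `aHiQ`, `wLoQ` — which is what makes minorant cells with thousands of series terms
(accuracy `10⁻⁹`) affordable in `decide +kernel`. Soundness: `aLoZ_le`, `le_aHiZ`, `wSumLoZ_le`,
and the certified lower bound `wLoZ_le` (`ψ(1/4)_lo + Σ + integral-test tail ≤ Re ψ(1/4 + iu/2)`).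
Everything here is proved; no named facts.

## References

* H. Yoshida, *On Hermitian forms attached to zeta functions*, Adv. Stud. Pure Math. 21 (1992), §6.
  [Yoshida1992]
-/

noncomputable section

open Real Set
open scoped BigOperators

namespace Literature.NumberTheory.LFunctions

open Literature.Analysis.SpecialFunctions

/-! ## Structural natural-number sums -/

/-- `Σ_{m<n} f m` as a structural recursion on `ℕ` (kernel-friendly). [folklore] -/
def sumN (n : ℕ) (f : ℕ → ℕ) : ℕ := Nat.rec 0 (fun m acc ↦ acc + f m) n

/-- `sumN 0 f = 0`. [folklore] -/
theorem sumN_zero (f : ℕ → ℕ) : sumN 0 f = 0 := rfl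

/-- `sumN (n+1) f = sumN n f + f n`. [folklore] -/
theorem sumN_succ (n : ℕ) (f : ℕ → ℕ) : sumN (n + 1) f = sumN n f + f n := rfl

/-- `sumN n f = Σ_{m ∈ range n} f m`. [folklore] -/
theorem sumN_eq_sum (n : ℕ) (f : ℕ → ℕ) : sumN n f = ∑ m ∈ Finset.range n, f m := by
  induction n with
  | zero => rfl
  | succ n ih => rw [sumN_succ, ih, Finset.sum_range_succ]

/-! ## The common denominator -/

/-- `N_m = (4m+1)² 4^{j−1} + a²` (`l_m² + u² = N_m/4^j` for `u = a/2^j`, `l_m = (4m+1)/2`). [folklore] -/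
def nodeSqZ (a j m : ℕ) : ℕ := (4 * m + 1) ^ 2 * 4 ^ (j - 1) + a ^ 2

/-- `N_m = 4^j (l_m² + u²)` over `ℝ` (`j ≥ 1`). [folklore] -/
theorem nodeSqZ_cast (a : ℕ) {j : ℕ} (hj : 1 ≤ j) (m : ℕ) :
    ((nodeSqZ a j m : ℕ) : ℝ) = 4 ^ j * (digammaNode m ^ 2 + ((a : ℝ) / 2 ^ j) ^ 2) := by
  unfold nodeSqZ digammaNode
  obtain ⟨i, rfl⟩ := Nat.exists_eq_add_of_le hj
  push_cast
  simp only [Nat.add_sub_cancel_left]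
  have h4 : (4 : ℝ) ^ (1 + i) = 4 * 4 ^ i := by rw [pow_add, pow_one]
  have h2 : ((2 : ℝ) ^ (1 + i)) ^ 2 = 4 ^ (1 + i) := by
    rw [← pow_mul, mul_comm, pow_mul]; norm_num
  rw [div_pow, h2, h4]
  field_simp
  ring

/-- `N_m > 0`. [folklore] -/
theorem nodeSqZ_pos (a j m : ℕ) : 0 < nodeSqZ a j m := by
  unfold nodeSqZ; positivity

/-! ## Directed roundings of the coefficient terms `2l_m/(l_m² + u²)^{k+2}` -/

/-- `⌊2^p · 2l_m/(l_m² + u²)^{k+2}⌋` as a natural-number division. [folklore] -/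
def aTermLoZ (p a j m k : ℕ) : ℕ :=
  ((4 * m + 1) * 4 ^ (j * (k + 2)) * 2 ^ p) / nodeSqZ a j m ^ (k + 2)

/-- `⌈2^p · 2l_m/(l_m² + u²)^{k+2}⌉` as a natural-number division. [folklore] -/
def aTermHiZ (p a j m k : ℕ) : ℕ :=
  ((4 * m + 1) * 4 ^ (j * (k + 2)) * 2 ^ p + nodeSqZ a j m ^ (k + 2) - 1) / nodeSqZ a j m ^ (k + 2)

/-- The exact value of the un-rounded quotient. [folklore] -/
theorem aTerm_exact (p a : ℕ) {j : ℕ} (hj : 1 ≤ j) (m k : ℕ) :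
    (((4 * m + 1) * 4 ^ (j * (k + 2)) * 2 ^ p : ℕ) : ℝ) / ((nodeSqZ a j m ^ (k + 2) : ℕ) : ℝ) / 2 ^ p =
      2 * digammaNode m / (digammaNode m ^ 2 + ((a : ℝ) / 2 ^ j) ^ 2) ^ (k + 2) := by
  have hA : 0 < digammaNode m ^ 2 + ((a : ℝ) / 2 ^ j) ^ 2 := by
    have := digammaNode_pos m; positivity
  push_cast
  rw [nodeSqZ_cast a hj m, mul_pow, ← pow_mul]
  have e : ((4 : ℝ) * m + 1) = 2 * digammaNode m := by unfold digammaNode; ring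
  rw [e]
  field_simp

/-- `aTermLoZ/2^p ≤ 2l_m/(l_m² + u²)^{k+2}`. [folklore] -/
theorem aTermLoZ_le (p a : ℕ) {j : ℕ} (hj : 1 ≤ j) (m k : ℕ) :
    ((aTermLoZ p a j m k : ℕ) : ℝ) / 2 ^ p ≤
      2 * digammaNode m / (digammaNode m ^ 2 + ((a : ℝ) / 2 ^ j) ^ 2) ^ (k + 2) := by
  rw [← aTerm_exact p a hj m k]
  unfold aTermLoZ
  exact div_le_div_of_nonneg_right Nat.cast_div_le (by positivity)

/-- Ceiling division dominates the quotient: `A ≤ ((A + B − 1)/B) · B` for `B > 0`. [folklore] -/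
theorem le_ceilDiv_mul {A B : ℕ} (hB : 0 < B) : A ≤ (A + B - 1) / B * B := by
  have h := Nat.lt_div_mul_add (a := A + B - 1) hB
  have hB1 : 1 ≤ B := hB
  omega

/-- `2l_m/(l_m² + u²)^{k+2} ≤ aTermHiZ/2^p`. [folklore] -/
theorem le_aTermHiZ (p a : ℕ) {j : ℕ} (hj : 1 ≤ j) (m k : ℕ) :
    2 * digammaNode m / (digammaNode m ^ 2 + ((a : ℝ) / 2 ^ j) ^ 2) ^ (k + 2) ≤
      ((aTermHiZ p a j m k : ℕ) : ℝ) / 2 ^ p := by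
  rw [← aTerm_exact p a hj m k]
  unfold aTermHiZ
  refine div_le_div_of_nonneg_right ?_ (by positivity)
  have hB := pow_pos (nodeSqZ_pos a j m) (k + 2)
  rw [div_le_iff₀ (by exact_mod_cast hB)]
  exact_mod_cast le_ceilDiv_mul hB

/-- `Σ_{m<M} ⌊2^p · 2l_m/(l_m² + u²)^{k+2}⌋`. [folklore] -/
def aLoZ (p a j M k : ℕ) : ℕ := sumN M fun m ↦ aTermLoZ p a j m k

/-- `Σ_{m<M} ⌈2^p · 2l_m/(l_m² + u²)^{k+2}⌉`. [folklore] -/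
def aHiZ (p a j M k : ℕ) : ℕ := sumN M fun m ↦ aTermHiZ p a j m k

/-- `aLoZ/2^p ≤ Σ_{m<M} 2l_m/(l_m² + u²)^{k+2}`. [folklore] -/
theorem aLoZ_le (p a : ℕ) {j : ℕ} (hj : 1 ≤ j) (M k : ℕ) :
    ((aLoZ p a j M k : ℕ) : ℝ) / 2 ^ p ≤
      ∑ m ∈ Finset.range M, 2 * digammaNode m / (digammaNode m ^ 2 + ((a : ℝ) / 2 ^ j) ^ 2) ^ (k + 2) := by
  unfold aLoZ
  rw [sumN_eq_sum, Nat.cast_sum, Finset.sum_div]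
  exact Finset.sum_le_sum fun m _ ↦ aTermLoZ_le p a hj m k

/-- `Σ_{m<M} 2l_m/(l_m² + u²)^{k+2} ≤ aHiZ/2^p`. [folklore] -/
theorem le_aHiZ (p a : ℕ) {j : ℕ} (hj : 1 ≤ j) (M k : ℕ) :
    ∑ m ∈ Finset.range M, 2 * digammaNode m / (digammaNode m ^ 2 + ((a : ℝ) / 2 ^ j) ^ 2) ^ (k + 2) ≤
      ((aHiZ p a j M k : ℕ) : ℝ) / 2 ^ p := by
  unfold aHiZ
  rw [sumN_eq_sum, Nat.cast_sum, Finset.sum_div]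
  exact Finset.sum_le_sum fun m _ ↦ le_aTermHiZ p a hj m k

/-! ## The series of `f_{l_m}(u)` itself -/

/-- `⌊2^p · f_{l_m}(u)⌋`, `f_{l_m}(u) = 4a²/((4m+1) N_m)`. [folklore] -/
def wTermLoZ (p a j m : ℕ) : ℕ := (4 * a ^ 2 * 2 ^ p) / ((4 * m + 1) * nodeSqZ a j m)

/-- The exact value of the un-rounded quotient. [folklore] -/
theorem wTerm_exact (p a : ℕ) {j : ℕ} (hj : 1 ≤ j) (m : ℕ) :
    (((4 * a ^ 2 * 2 ^ p : ℕ) : ℝ)) / (((4 * m + 1) * nodeSqZ a j m : ℕ) : ℝ) / 2 ^ p =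
      digammaTerm (digammaNode m) ((a : ℝ) / 2 ^ j) := by
  have hl := digammaNode_pos m
  have hA : 0 < digammaNode m ^ 2 + ((a : ℝ) / 2 ^ j) ^ 2 := by positivity
  unfold digammaTerm
  push_cast
  rw [nodeSqZ_cast a hj m]
  have e : ((4 : ℝ) * m + 1) = 2 * digammaNode m := by unfold digammaNode; ring
  rw [e]
  have h2 : ((2 : ℝ) ^ j) ^ 2 = 4 ^ j := by rw [← pow_mul, mul_comm, pow_mul]; norm_num
  field_simp
  rw [h2]
  ring

/-- `wTermLoZ/2^p ≤ f_{l_m}(u)`. [folklore] -/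
theorem wTermLoZ_le (p a : ℕ) {j : ℕ} (hj : 1 ≤ j) (m : ℕ) :
    ((wTermLoZ p a j m : ℕ) : ℝ) / 2 ^ p ≤ digammaTerm (digammaNode m) ((a : ℝ) / 2 ^ j) := by
  rw [← wTerm_exact p a hj m]
  unfold wTermLoZ
  exact div_le_div_of_nonneg_right Nat.cast_div_le (by positivity)

/-- `Σ_{m<M} ⌊2^p · f_{l_m}(u)⌋`. [folklore] -/
def wSumLoZ (p a j M : ℕ) : ℕ := sumN M fun m ↦ wTermLoZ p a j m

/-- `wSumLoZ/2^p ≤ Σ_{m<M} f_{l_m}(u)`. [folklore] -/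
theorem wSumLoZ_le (p a : ℕ) {j : ℕ} (hj : 1 ≤ j) (M : ℕ) :
    ((wSumLoZ p a j M : ℕ) : ℝ) / 2 ^ p ≤
      ∑ m ∈ Finset.range M, digammaTerm (digammaNode m) ((a : ℝ) / 2 ^ j) := by
  unfold wSumLoZ
  rw [sumN_eq_sum, Nat.cast_sum, Finset.sum_div]
  exact Finset.sum_le_sum fun m _ ↦ wTermLoZ_le p a hj m

/-- **Certified lower bound for `Re ψ(1/4 + iu/2)` at a dyadic `u = a/2^j`, integer form:**
`ψ(1/4)_lo + wSumLoZ/2^p + rd(u²/(2(l_M² + u²)))` (with the twelve-digit `psiQuarterLo20`). [folklore] -/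
def wLoZ (p a j M : ℕ) : ℚ :=
  psiQuarterLo20 + ((wSumLoZ p a j M : ℕ) : ℚ) / 2 ^ p + ratRd p (wTailLoQ₂ ((a : ℚ) / 2 ^ j) M)

/-- **Soundness of `wLoZ`**: `wLoZ p a j M ≤ Re ψ(1/4 + iu/2)`, `u = a/2^j`, `j ≥ 1`. [folklore] -/
theorem wLoZ_le (p a : ℕ) {j : ℕ} (hj : 1 ≤ j) (M : ℕ) :
    ((wLoZ p a j M : ℚ) : ℝ) ≤ reDigammaQuarter ((a : ℝ) / 2 ^ j) := by
  have h := sum_digammaTerm_add_logTail_le M ((a : ℝ) / 2 ^ j)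
  have h1 := wSumLoZ_le p a hj M
  have h2 : ((ratRd p (wTailLoQ₂ ((a : ℚ) / 2 ^ j) M) : ℚ) : ℝ) ≤
      1 / 2 * Real.log (1 + ((a : ℝ) / 2 ^ j) ^ 2 / digammaNode M ^ 2) := by
    refine le_trans ?_ (sq_div_le_half_log M ((a : ℝ) / 2 ^ j))
    have e : (((a : ℚ) / 2 ^ j : ℚ) : ℝ) = (a : ℝ) / 2 ^ j := by push_cast; ring
    rw [← e, ← wTailLoQ₂_cast]
    exact_mod_cast ratRd_le p (wTailLoQ₂ ((a : ℚ) / 2 ^ j) M)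
  have h3 := psiQuarterLo20_le'
  unfold wLoZ
  push_cast
  linarith

end Literature.NumberTheory.LFunctions
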